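import Summits.AtomisticToContinuum.Crystallization.Theorems.ChargedEnergyGapDeepRigidity

/-!
# `PricedLinkCensus.ChargedEnergyGap` (stmt-AtomisticToContinuum-14231) — the LOCAL-DENSITY dial on the improvable piece IP
# (decomp-a2c lens 3, generation 44; part F-C, over part F-B; critic row 868 docket (3): IP's first lemma typed for a hand)

IP `ImprovablePricing θ ε R r η` (part E) is TRUE-type («additivity of disjoint surgeries»).  Typing its first lemma shows the additivity
is NOT the first obstacle: a compact gross charged site constrains the points of `Q` only through its first shell and its site energy, so
arbitrarily many points of `Q` (a rattler cloud on the minimum sphere) and arbitrarily many compact sites may sit within any fixed distance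
of it; cross terms between simultaneous surgeries and packing multiplicities are then unbounded.  The LOCAL-DENSITY DIAL separates this:
§1 `nbrCount s Q p` (points of `Q` within `s` of `p`), `SparseAt s m Q p := nbrCount s Q p ≤ m`; period invariance, presentation freeness.
§2 EXACT SPLIT `IP ⟺ IPS ∧ IPD` (★ `improvablePricing_iff_sparse_dense`): IPS `SparseImprovablePricing … s m` prices the `(s, m)`-sparse
   improvable compact sites, IPD `DenseImprovablePricing … s m` the `(s, m)`-dense ones.  Both WEAKER than IP (proved).
§3 THE HANDS' STUBS for IPS, typed: SIP `SeparatedSurgeryPricing` (a uniformly priced ORBIT-SEPARATED family of sparse improvable compact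
   sites — the simultaneous-surgery lemma) and PK `SparsePacking` (every `Q` carries an orbit-`D`-separated such family capturing a fixed
   fraction `1/N(D)` of the species — greedy maximal family + bounded multiplicity, which is where sparseness is used); glue PROVED:
   ★ `sparseImprovablePricing_of_separated_packing : SIP → PK → IPS`, and `SIP ⟸ IPS` (proved).  §3b likewise for IPD: CP `CrowdedPricing`
   (periodic analogue of the tree's finite `card_crowded_le_excess`) and CM `CrowdingMultiplicity … 65` (volume packing); glue PROVED.
§4 Record `(s, m) = (1/2, 300)` and the cone by name to `ChargedEnergyGap`.
Tags.  IPS `(1/2, 300)` · WEAKER(proved) · TRUE-type · ATTACKABLE (⟸ SIP ∧ PK, glue proved).  IPD `(1/2, 300)` · WEAKER(proved) · TRUE-type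
(repulsive-core pricing: `≥ 301` points in a ball of radius `1/2` carry pair repulsion `≥ LJ(1/2)·(n²/54 − n/2) ≈ 300 n²` against an attraction
budget `≤ 135 n` per point from sparse surroundings and `≤ 135 Σ nᵢ²` between dense balls, and `U ≥ e⋆ N` on the sparse remainder
[BlancLewin2015 §2]; superstability [Ruelle1970]) · INSTRUMENTABLE.  SIP · TRUE-type modulo TAMENESS of the chosen surgeries (why it might
fail: `Improvable` provides SOME surgery; its change set inside `B_r` is not controlled by sparseness at scale `s < r`, so cross terms need
either tame surgeries or the dense fallback).  PK · TRUE-type (pure geometry of sparse point sets; covering numbers of `E3`).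
-/

noncomputable section

open scoped Classical
open Literature.MathematicalPhysics.StatisticalMechanics
open Literature.Geometry.DiscreteGeometry
open Summit.AtomisticToContinuum.Crystallization.Theses.PricedLinkCensus
open Summit.AtomisticToContinuum.Crystallization.Theorems.ChargedEnergyGapNegative

namespace Summit.AtomisticToContinuum.Crystallization.Theorems.ChargedEnergyGapChartDial

/-! ## §1 Local density at a point -/

/-- Number of points of `Q` within distance `s` of the point `p` (`0` if infinite, which does not happen). -/
def nbrCount (s : ℝ) (Q : PeriodicConfiguration 3) (p : E3) : ℕ :=
  Nat.card {q : Q.points // dist p (q : E3) ≤ s}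

/-- `(s, m)`-SPARSE point: at most `m` points of `Q` within `s`. -/
def SparseAt (s : ℝ) (m : ℕ) (Q : PeriodicConfiguration 3) (p : E3) : Prop :=
  nbrCount s Q p ≤ m

/-- The local count is invariant under the periods. -/
theorem nbrCount_add_period (s : ℝ) (Q : PeriodicConfiguration 3) {g : E3} (hg : g ∈ Q.lattice) (p : E3) :
    nbrCount s Q (p + g) = nbrCount s Q p := by
  unfold nbrCount
  exact (Nat.card_congr ((Blocks.transl Q hg).subtypeEquiv fun q => by simp [Blocks.transl, dist_add_right])).symm

/-- Sparseness is invariant under the periods. -/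
theorem sparseAt_add_period (s : ℝ) (m : ℕ) (Q : PeriodicConfiguration 3) {g : E3} (hg : g ∈ Q.lattice) (p : E3) :
    SparseAt s m Q (p + g) ↔ SparseAt s m Q p := by
  unfold SparseAt; rw [nbrCount_add_period s Q hg p]

/-- The local count only reads the point set. -/
theorem nbrCount_congr_points (s : ℝ) {P Q : PeriodicConfiguration 3} (h : P.points = Q.points) (p : E3) :
    nbrCount s P p = nbrCount s Q p := by
  simp only [nbrCount]; rw [h]

/-! ## §2 The exact sparse / dense split of IP -/

/-- Number of `(s, m)`-sparse `(r, η)`-improvable compact gross charged motif sites. -/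
def motifCompactImprovableSparse (θ ε R r η s : ℝ) (m : ℕ) (Q : PeriodicConfiguration 3) : ℕ :=
  Nat.card {x : Q.motif //
    (((Charged Q x ∧ ¬ ChartedAt θ Q (pt Q x)) ∧ ¬ Exposed ε R Q x) ∧ Improvable r η Q x) ∧ SparseAt s m Q x}

/-- Number of `(s, m)`-dense `(r, η)`-improvable compact gross charged motif sites. -/
def motifCompactImprovableDense (θ ε R r η s : ℝ) (m : ℕ) (Q : PeriodicConfiguration 3) : ℕ :=
  Nat.card {x : Q.motif //
    (((Charged Q x ∧ ¬ ChartedAt θ Q (pt Q x)) ∧ ¬ Exposed ε R Q x) ∧ Improvable r η Q x) ∧ ¬ SparseAt s m Q x}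

/-- improvable = dense + sparse. -/
theorem motifCompactImprovable_eq_dense_add_sparse (θ ε R r η s : ℝ) (m : ℕ) (Q : PeriodicConfiguration 3) :
    motifCompactImprovable θ ε R r η Q =
      motifCompactImprovableDense θ ε R r η s m Q + motifCompactImprovableSparse θ ε R r η s m Q :=
  natCard_subtype_split
    (fun x : Q.motif => ((Charged Q x ∧ ¬ ChartedAt θ Q (pt Q x)) ∧ ¬ Exposed ε R Q x) ∧ Improvable r η Q x)
    (fun x => SparseAt s m Q x)

/-- piece IPS · WEAKER(proved) · TRUE-type · ATTACKABLE (⟸ SIP ∧ PK, `sparseImprovablePricing_of_separated_packing`).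
**Sparse improvable pricing**: `κ` per `(s, m)`-sparse `(r, η)`-improvable compact gross charged motif site. -/
def SparseImprovablePricing (θ ε R r η s : ℝ) (m : ℕ) : Prop :=
  ∃ κ : ℝ, 0 < κ ∧ ∀ Q : PeriodicConfiguration 3, κ * (motifCompactImprovableSparse θ ε R r η s m Q : ℝ) ≤ excess Q

/-- piece IPD · WEAKER(proved) · TRUE-type (repulsive-core pricing relative to `e⋆`; record `(1/2, 300)`) · INSTRUMENTABLE.
**Dense improvable pricing**: `κ` per `(s, m)`-dense `(r, η)`-improvable compact gross charged motif site. -/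
def DenseImprovablePricing (θ ε R r η s : ℝ) (m : ℕ) : Prop :=
  ∃ κ : ℝ, 0 < κ ∧ ∀ Q : PeriodicConfiguration 3, κ * (motifCompactImprovableDense θ ε R r η s m Q : ℝ) ≤ excess Q

/-- ★ **THE DENSITY DIAL ON IP IS EXACT**: `IP ⟺ IPS ∧ IPD` for every `θ ε R r η s m`. -/
theorem improvablePricing_iff_sparse_dense (θ ε R r η s : ℝ) (m : ℕ) :
    ImprovablePricing θ ε R r η ↔ SparseImprovablePricing θ ε R r η s m ∧ DenseImprovablePricing θ ε R r η s m := by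
  rw [improvablePricing_iff_speciesPricing,
    speciesPricing_congr (c' := fun Q => motifCompactImprovableSparse θ ε R r η s m Q + motifCompactImprovableDense θ ε R r η s m Q)
      (fun Q => by rw [motifCompactImprovable_eq_dense_add_sparse θ ε R r η s m Q, add_comm]),
    speciesPricing_add_iff]
  exact Iff.rfl

/-- IPS is weaker than IP. -/
theorem sparseImprovablePricing_of_improvablePricing {θ ε R r η : ℝ} (s : ℝ) (m : ℕ) (h : ImprovablePricing θ ε R r η) :
    SparseImprovablePricing θ ε R r η s m :=
  ((improvablePricing_iff_sparse_dense θ ε R r η s m).1 h).1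

/-- IPD is weaker than IP. -/
theorem denseImprovablePricing_of_improvablePricing {θ ε R r η : ℝ} (s : ℝ) (m : ℕ) (h : ImprovablePricing θ ε R r η) :
    DenseImprovablePricing θ ε R r η s m :=
  ((improvablePricing_iff_sparse_dense θ ε R r η s m).1 h).2

/-! ## §3 The hands' stubs for IPS: separated simultaneous surgery and sparse packing; the glue -/

/-- The sparse improvable compact species read at a point of space (site-free; parts F-A, F-B, §1). -/
def SparseImprovableAt (θ ε R r η s : ℝ) (m : ℕ) (Q : PeriodicConfiguration 3) (p : E3) : Prop :=
  (CompactGrossAt θ ε R Q p ∧ ImprovableAt r η Q p) ∧ SparseAt s m Q p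

/-- At a motif site the site-free species is the counted species. -/
theorem sparseImprovableAt_coe_iff (θ ε R r η s : ℝ) (m : ℕ) (Q : PeriodicConfiguration 3) (x : Q.motif) :
    SparseImprovableAt θ ε R r η s m Q (x : E3) ↔
      (((Charged Q x ∧ ¬ ChartedAt θ Q (pt Q x)) ∧ ¬ Exposed ε R Q x) ∧ Improvable r η Q x) ∧ SparseAt s m Q x := by
  unfold SparseImprovableAt
  rw [compactGrossAt_coe_iff, ← improvable_iff_improvableAt]

/-- ORBIT-SEPARATED family: distinct members have all their lattice translates at distance `≥ D`. -/
def OrbitSeparated (D : ℝ) (Q : PeriodicConfiguration 3) (A : Finset E3) : Prop :=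
  ∀ a ∈ A, ∀ b ∈ A, a ≠ b → ∀ g ∈ Q.lattice, D ≤ dist a (b + g)

/-- stub SIP · TRUE-type modulo tameness of the surgeries (see header) · the simultaneous-surgery lemma, typed.
**Separated-surgery pricing**: for some separation `D`, a uniform `κ` per member of any orbit-`D`-separated family of sparse improvable
compact motif sites. -/
def SeparatedSurgeryPricing (θ ε R r η s : ℝ) (m : ℕ) : Prop :=
  ∃ D κ : ℝ, 0 < κ ∧ ∀ (Q : PeriodicConfiguration 3) (A : Finset E3),
    (∀ a ∈ A, a ∈ Q.motif ∧ SparseImprovableAt θ ε R r η s m Q a) → OrbitSeparated D Q A → κ * (A.card : ℝ) ≤ excess Q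

/-- stub PK · TRUE-type (pure geometry: greedy maximal separated family; multiplicity bounded by sparseness and a covering number).
**Sparse packing**: for every separation `D` some `N` such that every `Q` carries an orbit-`D`-separated family of sparse improvable
compact motif sites of size at least `1/N` of the species. -/
def SparsePacking (θ ε R r η s : ℝ) (m : ℕ) : Prop :=
  ∀ D : ℝ, ∃ N : ℕ, ∀ Q : PeriodicConfiguration 3, ∃ A : Finset E3,
    (∀ a ∈ A, a ∈ Q.motif ∧ SparseImprovableAt θ ε R r η s m Q a) ∧ OrbitSeparated D Q A ∧
      motifCompactImprovableSparse θ ε R r η s m Q ≤ N * A.card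

/-- A family of sparse improvable compact motif sites is no larger than the species count. -/
theorem card_le_motifCompactImprovableSparse {θ ε R r η s : ℝ} {m : ℕ} (Q : PeriodicConfiguration 3) {A : Finset E3}
    (hA : ∀ a ∈ A, a ∈ Q.motif ∧ SparseImprovableAt θ ε R r η s m Q a) :
    A.card ≤ motifCompactImprovableSparse θ ε R r η s m Q := by
  rw [← Nat.card_eq_finsetCard]
  exact Nat.card_le_card_of_injective
    (fun a : A => (⟨⟨a.1, (hA a.1 a.2).1⟩, (sparseImprovableAt_coe_iff θ ε R r η s m Q ⟨a.1, (hA a.1 a.2).1⟩).1 (hA a.1 a.2).2⟩ :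
      {x : Q.motif // (((Charged Q x ∧ ¬ ChartedAt θ Q (pt Q x)) ∧ ¬ Exposed ε R Q x) ∧ Improvable r η Q x) ∧ SparseAt s m Q x}))
    fun a b hab => Subtype.ext (by have h := congrArg (fun y => y.1.1) hab; exact h)

/-- SIP is weaker than IPS (a separated family is part of the species). -/
theorem separatedSurgeryPricing_of_sparseImprovablePricing {θ ε R r η s : ℝ} {m : ℕ} (h : SparseImprovablePricing θ ε R r η s m) :
    SeparatedSurgeryPricing θ ε R r η s m := by
  obtain ⟨κ, hκ, hS⟩ := h
  exact ⟨0, κ, hκ, fun Q A hA _ =>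
    (mul_le_mul_of_nonneg_left (Nat.cast_le.2 (card_le_motifCompactImprovableSparse Q hA)) hκ.le).trans (hS Q)⟩

/-- ★ **GLUE (proved)**: separated-surgery pricing and sparse packing give IPS, with constant `κ / N`. -/
theorem sparseImprovablePricing_of_separated_packing {θ ε R r η s : ℝ} {m : ℕ} (hS : SeparatedSurgeryPricing θ ε R r η s m)
    (hP : SparsePacking θ ε R r η s m) : SparseImprovablePricing θ ε R r η s m := by
  obtain ⟨D, κ, hκ, hS⟩ := hS
  obtain ⟨N, hN⟩ := hP D
  refine ⟨κ / (N + 1), div_pos hκ (by positivity), fun Q => ?_⟩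
  obtain ⟨A, hA, hsep, hcount⟩ := hN Q
  have h1 : (motifCompactImprovableSparse θ ε R r η s m Q : ℝ) ≤ (N + 1) * A.card := by
    have h2 : (motifCompactImprovableSparse θ ε R r η s m Q : ℝ) ≤ N * A.card := by exact_mod_cast hcount
    nlinarith [Nat.cast_nonneg (α := ℝ) A.card]
  have h3 := hS Q A hA hsep
  calc κ / (N + 1) * (motifCompactImprovableSparse θ ε R r η s m Q : ℝ)
      ≤ κ / (N + 1) * ((N + 1) * A.card) := mul_le_mul_of_nonneg_left h1 (div_pos hκ (by positivity)).le
    _ = κ * A.card := by field_simp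
    _ ≤ excess Q := h3

/-- IP from the three typed inputs: SIP, PK (for IPS) and IPD. -/
theorem improvablePricing_of_separated_packing_dense {θ ε R r η s : ℝ} {m : ℕ} (hS : SeparatedSurgeryPricing θ ε R r η s m)
    (hP : SparsePacking θ ε R r η s m) (hD : DenseImprovablePricing θ ε R r η s m) : ImprovablePricing θ ε R r η :=
  (improvablePricing_iff_sparse_dense θ ε R r η s m).2 ⟨sparseImprovablePricing_of_separated_packing hS hP, hD⟩

/-! ## §3b The hands' stubs for IPD: crowded pricing (tree template) and crowding multiplicity; the glue -/

/-- CROWDED point (periodic analogue of the tree's finite `ChargedEnergyGapGrossSurgery.Crowded`): another point of `Q` within `1/3`. -/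
def CrowdedAt (Q : PeriodicConfiguration 3) (p : E3) : Prop :=
  ∃ q ∈ Q.points, q ≠ p ∧ dist p q < 1 / 3

/-- Number of crowded motif sites. -/
def motifCrowded (Q : PeriodicConfiguration 3) : ℕ :=
  Nat.card {x : Q.motif // CrowdedAt Q x}

/-- stub CP · TRUE-type · ATTACKABLE (template: the tree's finite `card_crowded_le_excess` — a particle of a closest pair at distance `< 1/3`
has site energy `≥ 1 + r⁻³`; periodic version per cell).  **Crowded pricing**: `κ` per crowded motif site. -/
def CrowdedPricing : Prop :=
  ∃ κ : ℝ, 0 < κ ∧ ∀ Q : PeriodicConfiguration 3, κ * (motifCrowded Q : ℝ) ≤ excess Q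

/-- stub CM · TRUE-type (pure geometry; record `(1/2, 300, 65)`: non-crowded points are pairwise `≥ 1/3` apart, so a closed ball of radius
`1/2` holds at most `(2/3)³/(1/6)³ = 64` of them; a `(1/2, 300)`-dense site therefore has a crowded point within `1/2`, and a crowded point
serves at most `64` non-crowded dense motif sites and itself).  **Crowding multiplicity**: the dense improvable compact count is at most `M`
times the crowded count. -/
def CrowdingMultiplicity (θ ε R r η s : ℝ) (m M : ℕ) : Prop :=
  ∀ Q : PeriodicConfiguration 3, motifCompactImprovableDense θ ε R r η s m Q ≤ M * motifCrowded Q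

/-- ★ **GLUE (proved)**: crowded pricing and crowding multiplicity give IPD, with constant `κ / (M + 1)`. -/
theorem denseImprovablePricing_of_crowded {θ ε R r η s : ℝ} {m M : ℕ} (hC : CrowdedPricing)
    (hM : CrowdingMultiplicity θ ε R r η s m M) : DenseImprovablePricing θ ε R r η s m := by
  obtain ⟨κ, hκ, hC⟩ := hC
  refine ⟨κ / (M + 1), div_pos hκ (by positivity), fun Q => ?_⟩
  have h1 : (motifCompactImprovableDense θ ε R r η s m Q : ℝ) ≤ (M + 1) * motifCrowded Q := by
    have h2 : (motifCompactImprovableDense θ ε R r η s m Q : ℝ) ≤ M * motifCrowded Q := by exact_mod_cast hM Q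
    nlinarith [Nat.cast_nonneg (α := ℝ) (motifCrowded Q)]
  calc κ / (M + 1) * (motifCompactImprovableDense θ ε R r η s m Q : ℝ)
      ≤ κ / (M + 1) * ((M + 1) * motifCrowded Q) := mul_le_mul_of_nonneg_left h1 (div_pos hκ (by positivity)).le
    _ = κ * motifCrowded Q := by field_simp
    _ ≤ excess Q := hC Q

/-! ## §4 Record `(s, m) = (1/2, 300)` and the cone by name -/

/-- ★ **RECORD CONE with the density dial**, five leaves: `ChargedEnergyGap` from IPS · IPD · UC(deep-rigid, dense) · DP(deep-rigid, dilute) ·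
P-side at `(θ, ε, R, r, η, φ₀, s, m) = (3/20, 1/10, 6/5, 10, 1/100, 1/100, 1/2, 300)`. -/
theorem chargedEnergyGap_of_densityDial_record
    (hIS : SparseImprovablePricing (3 / 20) (1 / 10) (6 / 5) 10 (1 / 100) (1 / 2) 300)
    (hID : DenseImprovablePricing (3 / 20) (1 / 10) (6 / 5) 10 (1 / 100) (1 / 2) 300)
    (hU : UniversalCompetitor (motifCompactDeepRigid (3 / 20) (1 / 10) (6 / 5) 10 (1 / 100)) (1 / 100))
    (hDil : DilutePricing (motifCompactDeepRigid (3 / 20) (1 / 10) (6 / 5) 10 (1 / 100)) (1 / 100))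
    (hP : ChartedChargePricing (3 / 20)) : ChargedEnergyGap :=
  chargedEnergyGap_of_deepRigidity_record
    ((improvablePricing_iff_sparse_dense (3 / 20) (1 / 10) (6 / 5) 10 (1 / 100) (1 / 2) 300).2 ⟨hIS, hID⟩) hU hDil hP

/-- The same cone with IPS replaced by the hands' stubs SIP and PK. -/
theorem chargedEnergyGap_of_densityDial_stubs_record
    (hS : SeparatedSurgeryPricing (3 / 20) (1 / 10) (6 / 5) 10 (1 / 100) (1 / 2) 300)
    (hK : SparsePacking (3 / 20) (1 / 10) (6 / 5) 10 (1 / 100) (1 / 2) 300)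
    (hID : DenseImprovablePricing (3 / 20) (1 / 10) (6 / 5) 10 (1 / 100) (1 / 2) 300)
    (hU : UniversalCompetitor (motifCompactDeepRigid (3 / 20) (1 / 10) (6 / 5) 10 (1 / 100)) (1 / 100))
    (hDil : DilutePricing (motifCompactDeepRigid (3 / 20) (1 / 10) (6 / 5) 10 (1 / 100)) (1 / 100))
    (hP : ChartedChargePricing (3 / 20)) : ChargedEnergyGap :=
  chargedEnergyGap_of_densityDial_record (sparseImprovablePricing_of_separated_packing hS hK) hID hU hDil hP

/-- The same cone over the four hands' stubs SIP · PK · CP · CM (`M = 65`) in place of IP (six open leaves + two geometry stubs). -/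
theorem chargedEnergyGap_of_densityDial_allStubs_record
    (hS : SeparatedSurgeryPricing (3 / 20) (1 / 10) (6 / 5) 10 (1 / 100) (1 / 2) 300)
    (hK : SparsePacking (3 / 20) (1 / 10) (6 / 5) 10 (1 / 100) (1 / 2) 300) (hC : CrowdedPricing)
    (hM : CrowdingMultiplicity (3 / 20) (1 / 10) (6 / 5) 10 (1 / 100) (1 / 2) 300 65)
    (hU : UniversalCompetitor (motifCompactDeepRigid (3 / 20) (1 / 10) (6 / 5) 10 (1 / 100)) (1 / 100))
    (hDil : DilutePricing (motifCompactDeepRigid (3 / 20) (1 / 10) (6 / 5) 10 (1 / 100)) (1 / 100))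
    (hP : ChartedChargePricing (3 / 20)) : ChargedEnergyGap :=
  chargedEnergyGap_of_densityDial_stubs_record hS hK (denseImprovablePricing_of_crowded hC hM) hU hDil hP

end Summit.AtomisticToContinuum.Crystallization.Theorems.ChargedEnergyGapChartDial

end
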